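import Mathlib
import Summits.NavierStokesRegularity.NavierStokesRegularity.Theorems.WakeRatchetTailRatchet.Negative.TailRatchetFalseOfDyadicCauchyPostFiringBound
import HarnessLib

/-!
# `WakeRatchet.TailRatchet` (stmt-NavierStokesRegularity-21808), door D4′ — the post-firing bound (D) from
# UNIMODALITY + PEAK DELAY of the one-shell dyadic blow-up

Def-free reduction (`--supports stmt-NavierStokesRegularity-21808`).  The one estimate left on door D4′ is
`WakeRatchetDyadicPostFiring.DyadicCauchyPostFiringBound` — (D): after a shell of the one-shell non-negative dyadic cascade
`Ẋₙ = Λⁿ⁻¹Xₙ₋₁² − ΛⁿXₙXₙ₊₁` has reached the renormalised level `c = 1/(2(Λ+Λ⁻¹))` at time `t₁`, its amplitude obeys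
`ΛⁿXₙ(t₂) ≤ D/(T*−t₁)` ever after.  This file records the shape that (D) takes along the census route of
CENSUS-21808-leafhand4-g19.md (`cauchyPostFiringBound_of_unimodal`): (D) follows, with `D = max K 1 · 2Λ²/(Λ−1)²`, from

* (U) UNIMODALITY: every shell `n` has a time `pₙ ∈ [0,T*)` with `Xₙ` non-decreasing on `[0,pₙ]` and non-increasing on
  `[pₙ,T*)` (numerically: exactly one critical point for every `n ≥ 1` at every tested `Λ ∈ [1.15, 1.85]`; the boundary
  mechanism is the tree's `WakeRatchetDyadicWakeLock.shell_wake_lock`), and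
* (R′) PEAK DELAY: whenever shell `n` is at renormalised level `≥ c` at a time `t`, then `T* − t ≤ K (T* − pₙ)` (the peak
  follows the first firing within `log K` e-folds of the self-similar clock; numerically `log K ≈ 0.50 / 0.82 / 1.21` at
  `Λ = 1.3 / 1.5 / 1.7`),

using only the type-I frame bound `ΛⁿXₙ(t)(T*−t) ≤ 2Λ²/(Λ−1)²` that the Cauchy bundle of `DyadicCauchyPostFiringBound` already
carries (tree `WakeRatchetDyadicCauchy.dyadic_blowup_typeI`).  The pointwise core is `postFiring_of_unimodal_shell`.

HONEST FRAMING: MODEL lattice ODEs (Tao 2016 §1.2, §4); bookkeeping only — (U) and (R′) are NOT proved here, (D) is not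
proved, stmt-21808 is neither proved nor refuted and no stub of skeleton d00b85951d7c is closed; rung 0.
-/

noncomputable section

set_option linter.dupNamespace false

namespace Summit.NavierStokesRegularity.NavierStokesRegularity.Theorems

namespace WakeRatchetDyadicPostFiring

open Set
open Literature.Analysis.FluidPDE Literature.Analysis.FluidPDE.TaoCascade

/-- **One shell: unimodality + peak delay + type-I ⟹ the post-firing bound.**  Let `f ≥ ` be a real function on
`[0,T*)` (the amplitude `ΛⁿXₙ` of one shell), non-decreasing on `[0,p]` and non-increasing on `[p,T*)` for some
`p ∈ [0,T*)`, with the type-I bound `f(t)(T*−t) ≤ C` on `[0,T*)` and the peak delay `T*−t ≤ K(T*−p)` at every time `t` of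
level `≥ c`.  Then `f(t₂) ≤ max K 1 · C/(T*−t₁)` whenever `0 ≤ t₁ ≤ t₂ < T*` and `c ≤ f(t₁)(T*−t₁)`.
[cite: Tao2016AveragedNS, §1.2 (dyadic model); elementary bookkeeping (door D4′ of stmt-21808)] -/
theorem postFiring_of_unimodal_shell {f : ℝ → ℝ} {Tstar p C K c : ℝ} (hC : 0 ≤ C)
    (hp : p ∈ Ico 0 Tstar)
    (hmono : MonotoneOn f (Icc 0 p)) (hanti : AntitoneOn f (Ico p Tstar))
    (htypeI : ∀ t ∈ Ico 0 Tstar, f t * (Tstar - t) ≤ C)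
    (hdelay : ∀ t ∈ Ico 0 Tstar, c ≤ f t * (Tstar - t) → Tstar - t ≤ K * (Tstar - p))
    {t₁ t₂ : ℝ} (h₁ : 0 ≤ t₁) (h₁₂ : t₁ ≤ t₂) (h₂ : t₂ < Tstar) (hlev : c ≤ f t₁ * (Tstar - t₁)) :
    f t₂ ≤ max K 1 * C / (Tstar - t₁) := by
  have hT1 : 0 < Tstar - t₁ := by linarith
  have hTp : 0 < Tstar - p := by linarith [hp.2]
  have ht1 : t₁ ∈ Ico 0 Tstar := ⟨h₁, by linarith⟩
  have ht2 : t₂ ∈ Ico 0 Tstar := ⟨h₁.trans h₁₂, h₂⟩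
  have hK1 : 1 ≤ max K 1 := le_max_right _ _
  have hKK : K ≤ max K 1 := le_max_left _ _
  rcases le_or_gt p t₁ with hpt | hpt
  · -- after the peak: `f t₂ ≤ f t₁ ≤ C/(T*−t₁)`
    have hf : f t₂ ≤ f t₁ := hanti ⟨hpt, ht1.2⟩ ⟨hpt.trans h₁₂, h₂⟩ h₁₂
    have hb : f t₁ ≤ C / (Tstar - t₁) := by
      rw [le_div_iff₀ hT1]; exact htypeI t₁ ht1
    have hc : C / (Tstar - t₁) ≤ max K 1 * C / (Tstar - t₁) := by
      rw [mul_div_assoc]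
      exact le_mul_of_one_le_left (div_nonneg hC hT1.le) hK1
    linarith
  · -- before the peak: `f t₂ ≤ f p ≤ C/(T*−p) ≤ K C/(T*−t₁)`
    have hfp : f t₂ ≤ f p := by
      rcases le_or_gt t₂ p with h2p | h2p
      · exact hmono ⟨h₁.trans h₁₂, h2p⟩ ⟨hp.1, le_rfl⟩ h2p
      · exact hanti ⟨le_rfl, hp.2⟩ ⟨h2p.le, h₂⟩ h2p.le
    have hb : f p ≤ C / (Tstar - p) := by
      rw [le_div_iff₀ hTp]; exact htypeI p hp
    have hd : Tstar - t₁ ≤ K * (Tstar - p) := hdelay t₁ ht1 hlev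
    have hKpos : 0 < K := by
      by_contra hK
      have hK' : K ≤ 0 := not_lt.1 hK
      nlinarith
    have hc : C / (Tstar - p) ≤ K * C / (Tstar - t₁) := by
      rw [div_le_div_iff₀ hTp hT1]
      calc C * (Tstar - t₁) ≤ C * (K * (Tstar - p)) := mul_le_mul_of_nonneg_left hd hC
        _ = K * C * (Tstar - p) := by ring
    have he : K * C / (Tstar - t₁) ≤ max K 1 * C / (Tstar - t₁) := by
      rw [div_le_div_iff_of_pos_right hT1]
      exact mul_le_mul_of_nonneg_right hKK hC
    linarith

/-- **(U) + (R′) ⟹ (D).**  If at arbitrarily small scale ratios every Cauchy bundle of `DyadicCauchyPostFiringBound` (the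
one-shell non-negative dyadic blow-up with its type-I frame bound) is UNIMODAL shell by shell — `Xₙ` non-decreasing on
`[0,pₙ]`, non-increasing on `[pₙ,T*)` — with a uniform PEAK DELAY — `T*−t ≤ K(T*−pₙ)` whenever `ΛⁿXₙ(t)(T*−t) ≥ 1/(2(Λ+Λ⁻¹))`
— then the post-firing bound (D) holds (with `D = max K 1 · 2Λ²/(Λ−1)²`), hence door D4′ closes
(`TailRatchet_false_of_DyadicCauchyPostFiringBound`).
[cite: Tao2016AveragedNS, §1.2 (dyadic model), §4 Lemma 4.1 (4.8), §6.4; cell vocabulary (door D4′ of stmt-21808)] -/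
theorem cauchyPostFiringBound_of_unimodal
    (H : ∀ ε : ℝ, 0 < ε → ∃ ε₀ : ℝ, 0 < ε₀ ∧ ε₀ ≤ ε ∧
      ∀ (Tstar : ℝ) (X : ℤ → ℝ → ℝ), 0 < Tstar →
        (∀ n : ℤ, X n 0 = if n = 0 then 1 else 0) →
        (∀ n : ℤ, ∀ t ∈ Ioo (-(1 / ((bigLam ε₀ + (bigLam ε₀)⁻¹) * (1 + 1) ^ 2 + 1))) Tstar,
          HasDerivAt (X n) (bigLam ε₀ ^ (n - 1) * X (n - 1) t ^ 2 - bigLam ε₀ ^ n * X n t * X (n + 1) t) t) →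
        (∀ T', T' < Tstar → ∃ B : ℝ, ∀ n : ℤ,
          ∀ t ∈ Ioo (-(1 / ((bigLam ε₀ + (bigLam ε₀)⁻¹) * (1 + 1) ^ 2 + 1))) T', |bigLam ε₀ ^ n * X n t| ≤ B) →
        (∀ n : ℤ, ∀ t ∈ Ico 0 Tstar, 0 ≤ X n t) →
        (∀ n : ℤ, ∀ t ∈ Ico 0 Tstar,
          bigLam ε₀ ^ n * X n t * (Tstar - t) ≤ 2 * bigLam ε₀ ^ 2 / (bigLam ε₀ - 1) ^ 2) →
        (∀ t ∈ Ioo (-(1 / ((bigLam ε₀ + (bigLam ε₀)⁻¹) * (1 + 1) ^ 2 + 1))) Tstar, ∀ β : ℝ, 0 < β →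
          (∀ n : ℤ, |bigLam ε₀ ^ n * X n t| ≤ β) → 1 ≤ (bigLam ε₀ + (bigLam ε₀)⁻¹) * β * (Tstar - t)) →
        ∃ K : ℝ, ∀ n : ℤ, ∃ p ∈ Ico 0 Tstar,
          MonotoneOn (X n) (Icc 0 p) ∧ AntitoneOn (X n) (Ico p Tstar) ∧
          ∀ t ∈ Ico 0 Tstar, 1 / (2 * (bigLam ε₀ + (bigLam ε₀)⁻¹)) ≤ bigLam ε₀ ^ n * X n t * (Tstar - t) →
            Tstar - t ≤ K * (Tstar - p)) :
    DyadicCauchyPostFiringBound := by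
  intro ε hε
  obtain ⟨ε₀, hε₀, hle, H'⟩ := H ε hε
  refine ⟨ε₀, hε₀, hle, ?_⟩
  intro Tstar X hT h0 hlaw hreg hnn htypeI hlow
  obtain ⟨K, hK⟩ := H' Tstar X hT h0 hlaw hreg hnn htypeI hlow
  have hΛ : 0 < bigLam ε₀ := bigLam_pos (by linarith)
  set C : ℝ := 2 * bigLam ε₀ ^ 2 / (bigLam ε₀ - 1) ^ 2 with hCdef
  have hC : 0 ≤ C := by positivity
  refine ⟨max K 1 * C, fun n t₁ t₂ h₁ h₁₂ h₂ hlev => ?_⟩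
  obtain ⟨p, hp, hmono, hanti, hdelay⟩ := hK n
  have hΛn : 0 < bigLam ε₀ ^ n := zpow_pos hΛ n
  -- apply the one-shell lemma to `f = Λⁿ Xₙ`
  have hmono' : MonotoneOn (fun t => bigLam ε₀ ^ n * X n t) (Icc 0 p) :=
    fun a ha b hb hab => mul_le_mul_of_nonneg_left (hmono ha hb hab) hΛn.le
  have hanti' : AntitoneOn (fun t => bigLam ε₀ ^ n * X n t) (Ico p Tstar) :=
    fun a ha b hb hab => mul_le_mul_of_nonneg_left (hanti ha hb hab) hΛn.le
  exact postFiring_of_unimodal_shell (f := fun t => bigLam ε₀ ^ n * X n t) hC hp hmono' hanti'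
    (fun t ht => htypeI n t ht) (fun t ht hl => hdelay t ht hl) h₁ h₁₂ h₂ hlev

end WakeRatchetDyadicPostFiring

end Summit.NavierStokesRegularity.NavierStokesRegularity.Theorems

end
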